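import Summits.BirchSwinnertonDyer.BirchSwinnertonDyer.Theorems.PrintCf2RubinValueTwoTwistedKatoKummerLevels
import Literature.NumberTheory.ComplexMultiplication.EllipticUnits.KatoUnitRepIndependence
import HarnessLib

/-!
# F0b (zeta pins of `JohnsonLeungKings2011.TwistedIwasawaData`), FILE 3: the independence pin (Z2) at a Kato level, and the SYSTEM
# `(u_{𝔞,s}, β_{𝔞,s,k}, c_{𝔞,s,k})` of Kato representatives, roots and twisted Kummer classes over all levels with its laws

Cell `bsd-print-cf2`, WIDTH seat `bsd-line-cf2-p1-w5` g10 (prover-bsd-line-cf2-p1-w5-g10-0); construction F0b of route C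
(`PrintCf2RubinValueTwo`), plan `HOME/bsd-line-cf2-p1-w5/F0B-ASSEMBLY-PLAN-w5g9.md` steps 1–3 assembled and the Kato-level half of step 6;
`--supports` the deciding child stmt-BirchSwinnertonDyer-24721 (helper, Theses-free). THEOREMS ONLY (no definition, no named fact, no instance,
no `sorry`). The prints enter ONLY as displayed hypotheses: (E) `Kato2004.sec155_exists_katoUnitRep` (Kato §15.5, ty2 g38), (O1) de Shalit II.2.5 (i)
+ II.2.4 (i) (`DeShalit1987.prop25_i_normRelation`, `prop24_i_mem_rayClassField`, through -w2 g17's `KatoUnitRepNorm.exists_forall_normOver_katoUnitRep`),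
(O2) de Shalit II.2.4 (ii) (`DeShalit1987.prop24_ii_galoisAction`, through -w2 g17's `exists_katoUnitRep_indep`). HONEST FRAMING: bookkeeping
towards the EXISTENCE of ty2's pinned datum; nothing here closes the crux; no summit statement is proved by this seat; BSD is not proved by any
of this.

WHAT (`S = suppPF p 𝔣`, `U_s = katoLevelSubgroup p 𝔣 s`, `K` imaginary quadratic, `θ` trivial on `Gal(K̄/K(𝔣))`):
* §5 **`indep_at_katoLevel`** — (Z2) AT THE LEVEL `U_s`: `N𝔟•c_𝔞 − (χ(σ_𝔟)⁻¹ mod p^k)•conj_{σ_𝔟} c_𝔞 = N𝔞•c_𝔟 − (χ(σ_𝔞)⁻¹ mod p^k)•conj_{σ_𝔞} c_𝔟`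
  (`σ_𝔠 = layerArtin p 𝔣 s 𝔠`; JLK Prop. 3.3 (3) `_𝔟ζ^{N𝔞−σ_𝔞} = _𝔞ζ^{N𝔟−σ_𝔟}` on the twisted classes, transcription note (T3) of ty2's carriers
  file), from (O2) + the θ-scalar conjugation law (FILE 1) + the twelfth-root slack;
* §6 **`exists_katoKummerSystem`** — from (E) and (O1): a level `s₀ ≥ 1` and families `u a s` (Kato reps of `_𝔞z_{p^s𝔣}` for `s ≥ s₀`),
  `β a s k` (`p^k`-th roots of `(u a s)⁻¹`), `c a s k ∈ H¹(G_S(K(p^s𝔣)), μ_{p^k} ⊗ θ)` (their twisted Kummer classes), TOTAL in `(a, s, k)`, with the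
  REDUCTION LAW for all `(s, k)` and the NORM LAW `cor c_{a,s+1,k} = c_{a,s,k}` for `s ≥ s₀`, `s ≥ k + 2` — the norm-compatible system
  `(_𝔞z_{p^s𝔣})_s ⊗ t(χ)` of JLK §5.2 / Burungale–Flach §3.2 levelwise, before corestriction to the `ℤ_p²`-layers (FILE 4).

References: J. Johnson-Leung, G. Kings (2011) Def. 3.2, Prop. 3.3, §3.3 (5)–(6), Def. 3.5, §5.1–5.2; K. Kato, Astérisque 295 §15.5–15.6;
A. Burungale, M. Flach (2024) §3.2; E. de Shalit (1987) II.2.4–II.2.5.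
-/

noncomputable section

open scoped Classical

-- the summit namespace `Summit.BirchSwinnertonDyer.BirchSwinnertonDyer` repeats the problem name by design (D-0017)
set_option linter.dupNamespace false
set_option autoImplicit false

open scoped NumberField
open Field IsDedekindDomain IntermediateField
open Literature.NumberTheory.NumberFields (rayClassField)
open Literature.NumberTheory.GaloisRepresentations Literature.NumberTheory.GaloisRepresentations.DiscreteGaloisModule
open Literature.NumberTheory.GaloisRepresentations.LocalWeilDatum
open Literature.NumberTheory.EllipticCurves (IsImaginaryQuadratic)
open Literature.NumberTheory.ComplexMultiplication.EllipticUnits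
open Literature.NumberTheory.ComplexMultiplication.EllipticUnits.JohnsonLeungKings2011
open Summit.BirchSwinnertonDyer.BirchSwinnertonDyer.Theorems.PrintCf2.RowTwo
open Summit.BirchSwinnertonDyer.BirchSwinnertonDyer.Theorems.PrintCf2.KatoPUnits

namespace Summit.BirchSwinnertonDyer.BirchSwinnertonDyer.Theorems.PrintCf2.TwistedZeta

variable {K : Type} [Field K] [NumberField K] (p : ℕ) [Fact p.Prime] (θ : absoluteGaloisGroup K →ₜ* ℤ_[p]ˣ)
  (𝔣 : Ideal (𝓞 K))

/-! ## §5. The independence pin (Z2) at a Kato level -/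

/-- **THE (Z2) IDENTITY AT THE KATO LEVEL `U_s`** (`1 ≤ s`, `k + 2 ≤ s`, `K` imaginary quadratic): for admissible `𝔞, 𝔟`, Kato reps `u` of
`_𝔞z_{p^s𝔣}` and `v` of `_𝔟z_{p^s𝔣}`, roots `β_𝔞^{p^k} = u⁻¹`, `β_𝔟^{p^k} = v⁻¹` and their classes `c_𝔞, c_𝔟`:
`N𝔟•c_𝔞 − (χ(σ_𝔟)⁻¹ mod p^k)•conj_{σ_𝔟} c_𝔞 = N𝔞•c_𝔟 − (χ(σ_𝔞)⁻¹ mod p^k)•conj_{σ_𝔞} c_𝔟` with `σ_𝔠 = layerArtin p 𝔣 s 𝔠` — the levelwise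
form of ty2's `nsubElt 𝔟 • _𝔞ζ = nsubElt 𝔞 • _𝔟ζ` (Prop. 3.3 (3)). Proof: by the θ-scalar conjugation law (FILE 1) and
`χ(σ_𝔟) = θ(layerArtin s 𝔟)`, `(χ⁻¹ mod p^k)•conj_{σ_𝔟} c_𝔞` is THE class of `σ_𝔟β_𝔞`, so both sides are the classes of
`β_𝔞^{N𝔟}(σ_𝔟β_𝔞)⁻¹`, `β_𝔟^{N𝔞}(σ_𝔞β_𝔟)⁻¹`, whose `p^k`-th powers differ by `ζ⁻¹ = η^{p^k}`, `η ∈ K(p^s𝔣)`, by de Shalit II.2.4 (ii)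
(-w2 g17's `exists_katoUnitRep_indep`) and the twelfth-root slack.
[cite: JohnsonLeungKings2011, Prop. 3.3 (3) (arXiv p0009:L88–95, p0009:L122–p0010:L10), §3.3 (5) (p0010:L61–70), §5.1–5.2 (p0014:L18–26, L88–99)] [cite: deShalit1987, II.2.4 Proposition (ii)] [cite: Kato2004Asterisque, §15.5 (p. 253), §15.6 (p. 254)] -/
theorem indep_at_katoLevel (h24ii : DeShalit1987.prop24_ii_galoisAction) (hK : IsImaginaryQuadratic K) (ι : K →+* ℂ)
    (h𝔣 : 𝔣 ≠ ⊥) (hθ𝔣 : ∀ σ ∈ absGaloisFixingSubgroup (rayClassField K 𝔣), θ σ = 1) {s k : ℕ} (hs : 1 ≤ s) (hks : k + 2 ≤ s)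
    (a b : AuxIdeals p 𝔣) {u v βa βb : (AlgebraicClosure K)ˣ} (hu : IsKatoUnitRep p ι 𝔣 s a.1 u) (hv : IsKatoUnitRep p ι 𝔣 s b.1 v)
    (hβa : βa ^ (p ^ k) = u⁻¹) (hβb : βb ^ (p ^ k) = v⁻¹)
    {ca cb : levelCoh p (suppPF p 𝔣) θ (katoLevelSubgroup p 𝔣 s) k 1}
    (hca : IsTwistedKummerClass p θ (suppPF p 𝔣) (katoLevelSubgroup p 𝔣 s) k βa ca)
    (hcb : IsTwistedKummerClass p θ (suppPF p 𝔣) (katoLevelSubgroup p 𝔣 s) k βb cb) :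
    ((Ideal.absNorm b.1 : ℕ) : ℤ) • ca -
        ((PadicInt.toZModPow k (((thetaArtin p θ 𝔣 b)⁻¹ : ℤ_[p]ˣ) : ℤ_[p])).val : ℤ) •
          levelConj p (suppPF p 𝔣) θ (katoLevelSubgroup p 𝔣 s) k 1 (layerArtin p 𝔣 s b.1) ca =
      ((Ideal.absNorm a.1 : ℕ) : ℤ) • cb -
        ((PadicInt.toZModPow k (((thetaArtin p θ 𝔣 a)⁻¹ : ℤ_[p]ˣ) : ℤ_[p])).val : ℤ) •
          levelConj p (suppPF p 𝔣) θ (katoLevelSubgroup p 𝔣 s) k 1 (layerArtin p 𝔣 s a.1) cb := by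
  haveI : NumberField.IsTotallyComplex K := hK.2
  have hp : p.Prime := Fact.out
  have hU : IsOpen (katoLevelSubgroup p 𝔣 s : Set (absoluteGaloisGroup K)) := isOpen_absGaloisFixingSubgroup K (katoLayer p 𝔣 s)
  have hθU : ∀ σ ∈ katoLevelSubgroup p 𝔣 s, θ σ = 1 := fun σ hσ ↦ apply_eq_one_of_mem_katoLevelSubgroup p θ 𝔣 h𝔣 hθ𝔣 hσ
  have huF : (u : AlgebraicClosure K) ∈ katoLayer p 𝔣 s := hu.1.1
  have hvF : (v : AlgebraicClosure K) ∈ katoLayer p 𝔣 s := hv.1.1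
  have hNU : ramificationSubgroup K (suppPF p 𝔣) ≤ katoLevelSubgroup p 𝔣 s := ramificationSubgroup_suppPF_le_katoLevelSubgroup p 𝔣 h𝔣 s
  have hβaN := smul_eq_self_of_isTwistedKummerClass p θ hNU hca
  have hβbN := smul_eq_self_of_isTwistedKummerClass p θ hNU hcb
  -- classes of the conjugated roots
  have hβas : ((βa ^ (p ^ k) : (AlgebraicClosure K)ˣ) : AlgebraicClosure K) ∈ katoLayer p 𝔣 s := by
    rw [hβa, Units.val_inv_eq_inv_val]; exact inv_mem huF
  have hβbs : ((βb ^ (p ^ k) : (AlgebraicClosure K)ˣ) : AlgebraicClosure K) ∈ katoLayer p 𝔣 s := by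
    rw [hβb, Units.val_inv_eq_inv_val]; exact inv_mem hvF
  obtain ⟨ca', hca'⟩ := exists_isTwistedKummerClass_smul p θ 𝔣 h𝔣 hθ𝔣 (layerArtin p 𝔣 s b.1) hβaN hβas
  obtain ⟨cb', hcb'⟩ := exists_isTwistedKummerClass_smul p θ 𝔣 h𝔣 hθ𝔣 (layerArtin p 𝔣 s a.1) hβbN hβbs
  -- the θ-scalar conjugation law + scalar cancellation: `(χ(σ_𝔵)⁻¹ mod p^k) • conj_{σ_𝔵} c = c'`
  have key : ∀ (x : AuxIdeals p 𝔣) {β : (AlgebraicClosure K)ˣ} {c c' : levelCoh p (suppPF p 𝔣) θ (katoLevelSubgroup p 𝔣 s) k 1},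
      IsTwistedKummerClass p θ (suppPF p 𝔣) (katoLevelSubgroup p 𝔣 s) k β c →
      IsTwistedKummerClass p θ (suppPF p 𝔣) (katoLevelSubgroup p 𝔣 s) k (layerArtin p 𝔣 s x.1 • β) c' →
        ((PadicInt.toZModPow k (((thetaArtin p θ 𝔣 x)⁻¹ : ℤ_[p]ˣ) : ℤ_[p])).val : ℤ) •
          levelConj p (suppPF p 𝔣) θ (katoLevelSubgroup p 𝔣 s) k 1 (layerArtin p 𝔣 s x.1) c = c' := by
    intro x β c c' hc hc'
    have h2 := isTwistedKummerClass_levelConj_pow p (suppPF p 𝔣) θ k (katoLevelSubgroup p 𝔣 s) hc (layerArtin p 𝔣 s x.1)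
    rw [theta_layerArtin_eq_thetaArtin p θ 𝔣 h𝔣 hθ𝔣 s x] at h2
    have h1 : levelConj p (suppPF p 𝔣) θ (katoLevelSubgroup p 𝔣 s) k 1 (layerArtin p 𝔣 s x.1) c =
        (PadicInt.toZModPow k ((thetaArtin p θ 𝔣 x : ℤ_[p]ˣ) : ℤ_[p])).val • c' :=
      isTwistedKummerClass_unique p (suppPF p 𝔣) θ k (katoLevelSubgroup p 𝔣 s) h2
        (isTwistedKummerClass_pow p (suppPF p 𝔣) θ k (katoLevelSubgroup p 𝔣 s) hc' _)
    rw [h1, ← natCast_zsmul, smul_smul]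
    exact zsmul_val_inv_mul_val_eq_self p k (levelCoh_torsion p (suppPF p 𝔣) θ hU k 1 c') (thetaArtin p θ 𝔣 x)
  rw [key b hca hca', key a hcb hcb']
  -- both sides are classes of explicit radicands
  have hL := isTwistedKummerClass_pow_mul_inv p (suppPF p 𝔣) θ k (katoLevelSubgroup p 𝔣 s) hca hca' (Ideal.absNorm b.1)
  have hR := isTwistedKummerClass_pow_mul_inv p (suppPF p 𝔣) θ k (katoLevelSubgroup p 𝔣 s) hcb hcb' (Ideal.absNorm a.1)
  -- (O2): de Shalit II.2.4 (ii) through Kato's representatives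
  obtain ⟨ζ, hζ12, hζ⟩ := exists_katoUnitRep_indep p 𝔣 h24ii hK ι h𝔣 hs a.2 b.2 hu hv
  have hX0 : (v : AlgebraicClosure K) ^ Ideal.absNorm a.1 * (layerArtin p 𝔣 s a.1 • (v : AlgebraicClosure K))⁻¹ ≠ 0 :=
    mul_ne_zero (pow_ne_zero _ v.ne_zero) (inv_ne_zero (by rw [← Units.coe_smul]; exact Units.ne_zero _))
  have hζF : ζ ∈ katoLayer p 𝔣 s := by
    have e : ζ = (u : AlgebraicClosure K) ^ Ideal.absNorm b.1 * (layerArtin p 𝔣 s b.1 • (u : AlgebraicClosure K))⁻¹ *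
        ((v : AlgebraicClosure K) ^ Ideal.absNorm a.1 * (layerArtin p 𝔣 s a.1 • (v : AlgebraicClosure K))⁻¹)⁻¹ := by
      rw [hζ, mul_inv_cancel_right₀ hX0]
    rw [e]
    exact mul_mem (mul_mem (pow_mem huF _) (inv_mem (smul_mem_katoLayer p 𝔣 s _ huF)))
      (inv_mem (mul_mem (pow_mem hvF _) (inv_mem (smul_mem_katoLayer p 𝔣 s _ hvF))))
  have hζ0 : ζ ≠ 0 := by
    rintro rfl
    rw [zero_pow (by norm_num)] at hζ12
    exact zero_ne_one hζ12
  obtain ⟨η, hηF, hη⟩ := exists_pow_eq_of_pow_twelve_eq_one p 𝔣 h𝔣 hks (inv_mem hζF) (by rw [inv_pow, hζ12, inv_one])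
  have hη0 : η ≠ 0 := by
    rintro rfl
    rw [zero_pow (pow_ne_zero _ hp.ne_zero)] at hη
    exact inv_ne_zero hζ0 hη.symm
  have hηfix : ∀ σ ∈ katoLevelSubgroup p 𝔣 s, σ • Units.mk0 η hη0 = Units.mk0 η hη0 := fun σ hσ ↦
    smul_units_eq_self_of_mem_katoLevelSubgroup p 𝔣 hσ (by rw [Units.val_mk0]; exact hηF)
  -- the radicands' `p^k`-th powers differ by `η^{p^k} = ζ⁻¹`
  have hζ' := congrArg (·⁻¹) hζ
  simp only [mul_inv, inv_inv] at hζ'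
  have hβa' : (βa : AlgebraicClosure K) ^ (p ^ k) = (u : AlgebraicClosure K)⁻¹ := by
    rw [← Units.val_pow_eq_pow_val, hβa, Units.val_inv_eq_inv_val]
  have hβb' : (βb : AlgebraicClosure K) ^ (p ^ k) = (v : AlgebraicClosure K)⁻¹ := by
    rw [← Units.val_pow_eq_pow_val, hβb, Units.val_inv_eq_inv_val]
  have hpow : (βa ^ Ideal.absNorm b.1 * (layerArtin p 𝔣 s b.1 • βa)⁻¹) ^ (p ^ k) =
      Units.mk0 η hη0 ^ (p ^ k) * (βb ^ Ideal.absNorm a.1 * (layerArtin p 𝔣 s a.1 • βb)⁻¹) ^ (p ^ k) := by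
    rw [← Units.val_inj]
    simp only [Units.val_pow_eq_pow_val, Units.val_mul, Units.val_inv_eq_inv_val, Units.coe_smul, Units.val_mk0]
    rw [hη, mul_pow, mul_pow, inv_pow, inv_pow, ← smul_pow', ← smul_pow', ← pow_mul, ← pow_mul, mul_comm (Ideal.absNorm b.1),
      mul_comm (Ideal.absNorm a.1), pow_mul, pow_mul, hβa', hβb', inv_pow, inv_pow, smul_inv'', smul_inv'', inv_inv, inv_inv]
    exact hζ'
  exact eq_of_isTwistedKummerClass_of_pow_eq_pow_mul_pow p (suppPF p 𝔣) θ k (katoLevelSubgroup p 𝔣 s) hθU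
    (fun τ hτ ↦ apply_eq_one_of_mem_ramificationSubgroup p θ 𝔣 h𝔣 hθ𝔣 hτ)
    (fun τ hτ ξ hξ ↦ smul_eq_self_of_mem_ramificationSubgroup_suppPF p 𝔣 k hτ ξ hξ) hηfix hpow hL hR

/-! ## §6. The system of representatives, roots and classes over all levels -/

/-- **THE SYSTEM `(u, β, c)` OF KATO'S UNITS, ROOTS AND TWISTED KUMMER CLASSES OVER ALL LEVELS, WITH ITS LAWS.** From (E) (Kato reps exist at
all large levels, Kato §15.5 / JLK Prop. 3.3 (1)) and (O1) (`N u_{s+1} = ζ u_s`, `ζ^{12} = 1`, de Shalit II.2.5 / Kato (15.4.4), -w2 g17): there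
are `s₀ ≥ 1` and TOTAL families — `u a s` a Kato representative of `_𝔞z_{p^s𝔣}` for `s ≥ s₀` (a harmless `p`-unit below `s₀`),
`β a s k` with `(β a s k)^{p^k} = (u a s)⁻¹`, `c a s k ∈ H¹(G_S(K(p^s𝔣)), μ_{p^k} ⊗ θ)` a twisted Kummer class of `β a s k` — such that
(red) `red(c a s (k+1)) = c a s k` for all `s, k` and (norm) `cor_{K(p^{s+1}𝔣)/K(p^s𝔣)} (c a (s+1) k) = c a s k` for `s ≥ s₀`, `s ≥ k + 2`:
JLK's "`(_𝔞z_{p^s𝔣})_s ⊗ t(χ)`, norm compatible in the tower" (§5.2; Burungale–Flach §3.2, proof of Lemma 7) levelwise, the 12th-root ambiguity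
of the representatives absorbed (transcription note (T4) of ty2's carriers file). [cite: JohnsonLeungKings2011, Def. 3.2, Prop. 3.3 (1)(2), Def. 3.5, §5.2 (arXiv p0009:L55–95, p0010:L72–80, p0014:L80–90)] [cite: Kato2004Asterisque, §15.5 (p. 253)] [cite: BurungaleFlach2024, §3.2 (arXiv p0013:L30–36)] -/
theorem exists_katoKummerSystem (hE : Kato2004.sec155_exists_katoUnitRep) (h25 : DeShalit1987.prop25_i_normRelation)
    (h24i : DeShalit1987.prop24_i_mem_rayClassField) (hK : IsImaginaryQuadratic K) (ι : K →+* ℂ) (h𝔣 : 𝔣 ≠ ⊥)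
    (hθ𝔣 : ∀ σ ∈ absGaloisFixingSubgroup (rayClassField K 𝔣), θ σ = 1) :
    ∃ (s₀ : ℕ) (u : AuxIdeals p 𝔣 → ℕ → (AlgebraicClosure K)ˣ) (β : AuxIdeals p 𝔣 → ℕ → ℕ → (AlgebraicClosure K)ˣ)
      (c : ∀ (a : AuxIdeals p 𝔣) (s k : ℕ), levelCoh p (suppPF p 𝔣) θ (katoLevelSubgroup p 𝔣 s) k 1),
      1 ≤ s₀ ∧
      (∀ a s, s₀ ≤ s → IsKatoUnitRep p ι 𝔣 s a.1 (u a s)) ∧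
      (∀ a s, ((u a s : (AlgebraicClosure K)ˣ) : AlgebraicClosure K) ∈ katoLayer p 𝔣 s) ∧
      (∀ a s k, β a s k ^ (p ^ k) = (u a s)⁻¹) ∧
      (∀ a s k, IsTwistedKummerClass p θ (suppPF p 𝔣) (katoLevelSubgroup p 𝔣 s) k (β a s k) (c a s k)) ∧
      (∀ a s k, levelRed p (suppPF p 𝔣) θ (katoLevelSubgroup p 𝔣 s) k 1 (c a s (k + 1)) = c a s k) ∧
      (∀ a s k, s₀ ≤ s → k + 2 ≤ s →
        relCores p (suppPF p 𝔣) θ (katoLevelSubgroup_antitone p 𝔣 h𝔣 (Nat.le_succ s))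
          (isOpen_absGaloisFixingSubgroup K (katoLayer p 𝔣 s)) (isOpen_absGaloisFixingSubgroup K (katoLayer p 𝔣 (s + 1))) k 1
          (c a (s + 1) k) = c a s k) := by
  haveI : NumberField.IsTotallyComplex K := hK.2
  obtain ⟨s₁, hs₁⟩ := Kato2004.sec155_exists_katoUnitRep.eventually (p := p) hK ι h𝔣 hE
  obtain ⟨s₂, hs₂⟩ := KatoUnitRepNorm.exists_forall_normOver_katoUnitRep p 𝔣 h25 h24i hK ι h𝔣
  -- representatives (total in `s`: the unit `1` below the threshold)
  have H : ∀ (a : AuxIdeals p 𝔣) (s : ℕ), ∃ u : (AlgebraicClosure K)ˣ,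
      (max (max s₁ s₂) 1 ≤ s → IsKatoUnitRep p ι 𝔣 s a.1 u) ∧ u ∈ pUnitsOf p (katoLayer p 𝔣 s) := by
    intro a s
    by_cases h : max (max s₁ s₂) 1 ≤ s
    · obtain ⟨u, hu⟩ := hs₁ s ((le_max_left _ _).trans ((le_max_left _ _).trans h)) a.1 a.2
      exact ⟨u, fun _ ↦ hu, hu.1⟩
    · exact ⟨1, fun h' ↦ absurd h' h, one_mem _⟩
  choose u hu using H
  -- roots and classes (total in `s, k`)
  have H2 : ∀ (a : AuxIdeals p 𝔣) (s k : ℕ), ∃ (β : (AlgebraicClosure K)ˣ)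
      (c : levelCoh p (suppPF p 𝔣) θ (katoLevelSubgroup p 𝔣 s) k 1),
      β ^ (p ^ k) = (u a s)⁻¹ ∧ IsTwistedKummerClass p θ (suppPF p 𝔣) (katoLevelSubgroup p 𝔣 s) k β c :=
    fun a s k ↦ exists_root_isTwistedKummerClass_katoLayer p θ k 𝔣 h𝔣 hθ𝔣 s ((pUnitsOf p (katoLayer p 𝔣 s)).inv_mem (hu a s).2)
  choose β c hβc using H2
  refine ⟨max (max s₁ s₂) 1, u, β, c, le_max_right _ _, fun a s hs ↦ (hu a s).1 hs, fun a s ↦ (hu a s).2.1,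
    fun a s k ↦ (hβc a s k).1, fun a s k ↦ (hβc a s k).2, fun a s k ↦ ?_, fun a s k hs hks ↦ ?_⟩
  · exact levelRed_eq_of_isTwistedKummerClass p θ 𝔣 h𝔣 hθ𝔣 (by rw [(hβc a s (k + 1)).1, (hβc a s k).1]) (hβc a s k).2
      (hβc a s (k + 1)).2
  · have hus : IsKatoUnitRep p ι 𝔣 s a.1 (u a s) := (hu a s).1 hs
    have hus' : IsKatoUnitRep p ι 𝔣 (s + 1) a.1 (u a (s + 1)) := (hu a (s + 1)).1 (hs.trans (Nat.le_succ s))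
    obtain ⟨ζ, hζ, hN⟩ := hs₂ s ((le_max_right _ _).trans ((le_max_left _ _).trans hs)) a.1 a.2 (u a s) (u a (s + 1))
      hus hus' hus'.1.1
    exact relCores_eq_of_isTwistedKummerClass_of_normOver p θ 𝔣 h𝔣 hθ𝔣 hks hus.1.1 hus'.1.1 hζ hN (hβc a s k).1
      (hβc a (s + 1) k).1 (hβc a s k).2 (hβc a (s + 1) k).2

end Summit.BirchSwinnertonDyer.BirchSwinnertonDyer.Theorems.PrintCf2.TwistedZeta

end
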